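import Summits.QuantumFields.BalabanUV.Beta.SpineRecursiveW
import Summits.QuantumFields.BalabanUV.Beta.GAN24.WSlotCauchyOfShapes
import Summits.QuantumFields.BalabanUV.Beta.GAN24.KSlotAssembly
import Summits.QuantumFields.BalabanUV.Beta.HessKerCoDressedBmWall
import Summits.QuantumFields.BalabanUV.Beta.MixedJetTablesPlug

/-!
# `BalabanUV.Beta.GAN24.WrecAtSlotOfShapes` — binder row G-an2-4 ∕ (CONV-C), **CT-W SOCKET**: THE W-SLOT ROWS `(hW, hWall)` OF an2's RECURSIVE
# WALL FAMILY `SpineRooted.WrecAt` (the W-literal the D1 literal of record `D1BFx.RoadEndRowPinned.exists_allScalesSeq_JsRowD1Pin_of_slots` CONSUMES)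
# AS FUNCTIONS OF THE UNIT ROWS OF ITS TWO RECURSIVE SLOTS — the unfolded first-order tables `SpureRecAt` («S′Shape» ∧ «S′Drift») and the
# recursively typed second-order tables `T2RecAt` («T2Shape» ∧ «T2Drift») — with the DRESSED K-slot and the multiplier ∕ mixed tables DISCHARGED
# (`d = 3`, `Lc ≥ 2`, every in-block root; §1–§3 generic `d` with the dressed K rows as letters)

NOT IN PRINT; OUR BOOKKEEPING (road-P2 chair of row G-an2-4, unit `b2b-balaban-gan24-p2` gen 35, crux team (2); journal `CLAIMS.log` INTENT «CT-W SCOPING»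
[GAN24P2-G35-INTENT1]).  HONEST FRAMING (cell contract, verbatim): «discharging `BetaPertH` makes Bałaban's UV stability UNCONDITIONAL — a real
constructive-QFT result; it is NOT the continuum limit and NOT the Clay problem.»  HONEST DEPENDENCY (verbatim): «continuum YM on T⁴ ⇐ BetaPertH ∧ nine
spine estimates (0/9 proved); BetaPertH ⇐ (D1) ∧ (D4) ∧ CAP+tail; G-an2-4 gates asym, D1 and NE2/3/4.»

WHAT.  `WrecAt d Lc ρ cE cVH cΛ cE₂ cB T vh₂S mixFF j := W2SymOfK G_j Lc (SpureRecAt j) (M1At ρ cΛ j) (T2RecAt j) (M2Of mixFF j)`, `G_j = coDressKBmAt ρ Lc (KInvStep Lc j)`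
(`SpineRecursiveW` §3).  an1's carrier `W2SymOfK` is generic in all five slots and so are the tree's unit ∕ locality ∕ Lipschitz lemmas for it
(`SecondOrderUnits.unitW_W2SymOfK`, `SecondOrderResponse.vertexFamily₂_W2SymOfK`, leaf-07's `SecondOrderLipschitzW2.vertexFamily₂_W2SymOfK_sub`); hence the
two W-rows of the wall for the DRESSED family are — exactly as leaf-07's `WSlotOfShapes.hW_of_shapes` ∕ `WSlotCauchyOfShapes.hWall_of_shapes` are for an2's
Stage-B family `WbalOf` — FUNCTIONS of five row families: (K′) the unit rows of the DRESSED one-step resolvents `unitK (sfStep Lc j) (smStep d Lc j) G_j` (uniform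
decay ∧ geometric Cauchy) — a TREE THEOREM at `d = 3` (asym1's `HessKerCoDressedBmWall.exists_coDressedBm_unit_rows` over road P1's K-pair
`KSlotAssembly.convCKWall_holds`); (S′) the unit rows of `SpureRecAt ρ … j` = `SrecAt ρ … j` minus its Lagrange piece (`SrecAt_eq_SpureRecAt_add_lam_zero∕succ`) —
OPEN here as two letters (they follow from CT-4's (hS, hSall) of `SrecAt` and road S3's rooted Λ rows; a separate short file); (M′) the rooted multiplier table:
`unitM (sfStep Lc j) (smStep d Lc j) (M1At ρ cΛ j) = cΛ • hessFFAt ρ Lc` is `j`-FREE (`unitM_M1At_eq`, the rooted twin of leaf-07's `unitM_M1_eq`) and a vertex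
family at every rate (an1's `biLoc_hessFFAt`) — DISCHARGED; (T₂′) «T2Shape» ∧ «T2Drift» of `T2RecAt` — THE CRUX OF CT-W, OPEN, two letters (road W3's
END-as-function rows (F1)–(F4) of `WSlotT2OfPieces` over the dressed affine tower — `FP/PerfectBiStencilStep.unitS₂_T2RecOf_succ` is its rescaled step);
(M₂′) an1's mixed table: `unitM₂ … (M2Of mixFF j) = mixFF` (`unitM₂_M2Of_eq`) — DISCHARGED for `mixFFAt (toSite r) Lc` by `MixedJetTablesPlug.hmix_an1`.
## Contents
§0 `unitW_WrecAt` (the normalised member `j` IS the carrier over the normalised slots), `unitM_M1At_eq`, `vertexFamily_smul_hessFFAt`;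
§1 (generic `d`, in-block root) **`hW_WrecAt_of_shapes`** — hW ⟸ (K′)-uniform ∧ «S′Shape» ∧ «T2Shape» (+ mixed-table letters);
§2 **`hWall_WrecAt_of_shapes`** — hWall ⟸ (K′) ∧ «S′Shape» ∧ «S′Drift» ∧ «T2Shape» ∧ «T2Drift», ONE ratio `θW = max θK (max θS θ₂)`, ONE rate;
§3 **`hW_hWall_WrecAt_of_shapes`** — both at one common rate (the socket's shape);
§4 (`d = 3`, `2 ≤ Lc`, mixed table `mixFFAt (toSite r) Lc`) **`hW_hWall_WrecAt_three_of_rows`** — THE W-SLOT ROWS OF THE COMB FAMILY ⟸ «S′Shape» ∧ «S′Drift» ∧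
«T2Shape» ∧ «T2Drift» ALONE: LITERALLY the binders `hW`∕`hWall` (with `hδW`, `hθW0`, `hθW1`) of `exists_allScalesSeq_JsRowD1Pin_of_slots` at `r := ctrOff (3+1) Lc`,
`cE := Lc^4`, `cVH := −Lc^8∕2`, `cΛ := 2∕Lc^4`, `cE₂ := Lc^8`, `cB := −Lc^12∕4`, `T := (8N²)⁻¹ • wsym22 N`, `vh₂S := vh₂SAn1 Lc` (all generic here).
[folklore] compositions BY NAME; 0 `def`, 0 cited facts, 0 `def … : Prop`, 0 sorry; NO estimate of Bałaban's; discharges NOTHING of (hW, hWall): the ENDs are SOCKETS whose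
letters (S′) and (T₂′) are OPEN.  NEVER «G-an2-4 closed» as (CONV-C); NOT D1, NOT `BetaPertH`, NOT continuum, NOT Clay; not in print — our bookkeeping.
Unit `b2b-balaban-gan24-p2` (gen 35), 2026-08-21.
-/

noncomputable section

open Finset
open scoped BigOperators
open Literature.MathematicalPhysics.QuantumFieldTheory
open Literature.MathematicalPhysics.QuantumFieldTheory.Balaban1983to89
open Literature.MathematicalPhysics.QuantumFieldTheory.Balaban1983to89.Beta
open B12Sec2to5 (l1 l1_nonneg)
open ExpKernelCalculus (MKer Decays BiLoc VertexFamily VertexFamily₂ Zl)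
open OneStepResolventKernel (Fib LocStencil decays_mono biLoc_mono bound_mono)
open OneStepKernelFamily (KInvStep)
open AffineAveraging (box toSite)
open AveragingHessianKernels (ell)
open AveragingHessianKernelsRooted (hessFFAt hessFFAt_inl_inr hessFFAt_inr biLoc_hessFFAt)
open AveragingMixedJetTables (mixFFAt mixFFAt_inl_inr mixFFAt_inr)
open BalabanStepJets (vertexFamily₂_mono)
open BalabanCompositeJets (LocStencil₂)
open SecondOrderResponse (W2SymOfK LocStencilFM vertexFamily₂_W2SymOfK CW2)
open BalabanStepW2 (M2Of wM1)
open Summit.QuantumFields.BalabanUV.Beta.HessKerDressedUnits (unitK unitS unitW legScale_inl legScale_inr)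
open Summit.QuantumFields.BalabanUV.Beta.SecondOrderUnits (unitM unitS₂ unitM₂ unitM_apply unitW_W2SymOfK)
open Summit.QuantumFields.BalabanUV.Beta.AxialDressingRooted (coDressKBmAt)
open Summit.QuantumFields.BalabanUV.Beta.SpineRooted (SpureRecAt T2RecAt WrecAt M1At)
open Summit.QuantumFields.BalabanUV.Beta.HessKerCoDressedBmWall (exists_coDressedBm_unit_rows)
open Summit.QuantumFields.BalabanUV.Beta.MixedJetTablesPlug (hmix_an1)
open Summit.QuantumFields.BalabanUV.Beta.GAN24.CombesThomas (sfStep smStep UnitDecayK CauchyDecayK sfStep_ne_zero smStep_ne_zero)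
open Summit.QuantumFields.BalabanUV.Beta.GAN24.KSlotAssembly (convCKWall_holds)
open Summit.QuantumFields.BalabanUV.Beta.GAN24.StencilSlotOfShapes (locStencil_mono')
open Summit.QuantumFields.BalabanUV.Beta.GAN24.WSlotOfShapes (m1_unit_factor unitM₂_M2Of_eq locStencilFM_unitM₂_M2Of)
open Summit.QuantumFields.BalabanUV.Beta.GAN24.WSlotCauchyOfShapes (locStencil₂_le_mono vertexFamily_zero locStencilFM_zero mul_pow_le_mul_pow)
open Summit.QuantumFields.BalabanUV.Beta.GAN24.SecondOrderLipschitzW2 (LW2 LW2_mul vertexFamily₂_W2SymOfK_sub)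

namespace Summit.QuantumFields.BalabanUV.Beta.GAN24.WrecAtSlotOfShapes

variable {d : ℕ} {Lc : ℕ} [NeZero Lc]

/-! ## §0 The normalised member, the rooted multiplier table in units -/

/-- [folklore] **THE NORMALISED MEMBER `j` OF `WrecAt` IS an1's CARRIER OVER THE NORMALISED SLOTS** (`SecondOrderUnits.unitW_W2SymOfK` on the
definition `SpineRooted.WrecAt … j = W2SymOfK G_j Lc (SpureRecAt j) (M1At ρ cΛ j) (T2RecAt j) (M2Of mixFF j)`). -/
theorem unitW_WrecAt {sf sm : ℝ} (hsf : sf ≠ 0) (hsm : sm ≠ 0) (ρ : Fin (d + 1) → ℤ) (cE cVH cΛ cE₂ cB : ℝ)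
    (T : Fin 4 → Fin 4 → Fin 4 → Fin 4 → ℝ)
    (vh₂S mixFF : Fin (d + 1) → (Fin (d + 1) → ℤ) → Fin (d + 1) → (Fin (d + 1) → ℤ) → MKer (d + 1) (Fib d)) (j : ℕ) :
    unitW sf sm (WrecAt d Lc ρ cE cVH cΛ cE₂ cB T vh₂S mixFF j) =
      W2SymOfK (unitK sf sm (coDressKBmAt ρ Lc (KInvStep (d := d) Lc j))) Lc (unitS sf sm (SpureRecAt d Lc ρ cE cVH cΛ j))
        (unitM sf sm (M1At d Lc ρ cΛ j)) (unitS₂ sf sm (T2RecAt d Lc ρ cE cVH cΛ cE₂ cB T vh₂S mixFF j)) (unitM₂ sf sm (M2Of d Lc mixFF j)) :=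
  unitW_W2SymOfK (N := Lc) hsf hsm _ _ _ _ _

/-- [folklore] **THE ROOTED FIRST MULTIPLIER TABLE IN THE ADOPTED UNITS IS `j`-FREE**: `unitM (sfStep Lc j) (smStep d Lc j) (M1At ρ cΛ j) = cΛ • hessFFAt ρ Lc`
(the rooted twin of leaf-07's `WSlotOfShapes.unitM_M1_eq`: the weight `wM1 j = (Lc^j)^{2(d+2)}` cancels the unit factor exactly — `m1_unit_factor`; `hessFFAt` is
field–field-valued). -/
theorem unitM_M1At_eq (ρ : Fin (d + 1) → ℤ) (cΛ : ℝ) (j : ℕ) :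
    unitM (sfStep Lc j) (smStep d Lc j) (M1At d Lc ρ cΛ j) = fun μ w => cΛ • hessFFAt ρ Lc μ w := by
  have hfac := m1_unit_factor (d := d) (Lc := Lc) j
  funext μ w x z a b
  simp only [unitM_apply, M1At, Pi.smul_apply, smul_eq_mul]
  rcases a with α | m <;> rcases b with β | n
  · rw [legScale_inl, legScale_inl]
    calc (smStep d Lc j * smStep d Lc j)⁻¹ *
          ((sfStep Lc j)⁻¹ * (cΛ * wM1 d Lc j * hessFFAt ρ Lc μ w x z (Sum.inl α) (Sum.inl β)) * (sfStep Lc j)⁻¹)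
        = ((smStep d Lc j * smStep d Lc j)⁻¹ * ((sfStep Lc j)⁻¹ * (sfStep Lc j)⁻¹) * wM1 d Lc j) *
            (cΛ * hessFFAt ρ Lc μ w x z (Sum.inl α) (Sum.inl β)) := by ring
      _ = cΛ * hessFFAt ρ Lc μ w x z (Sum.inl α) (Sum.inl β) := by rw [hfac, one_mul]
  · simp only [hessFFAt_inl_inr, mul_zero, zero_mul]
  · simp only [hessFFAt_inr, mul_zero, zero_mul]
  · simp only [hessFFAt_inr, mul_zero, zero_mul]

omit [NeZero Lc] in
/-- [folklore] an1's ROOTED constraint Hessian with a colour weight is a vertex family at blocking `Lc`, at ANY rate `δ ≥ 0`, for a box root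
(`biLoc_hessFFAt`; rooted twin of leaf-07's `vertexFamily_smul_hessFF`). -/
theorem vertexFamily_smul_hessFFAt (hLc : 1 ≤ Lc) {r : Fin (d + 1) → ℕ} (hr : r ∈ box (d + 1) Lc) (cΛ : ℝ) {δ : ℝ} (hδ : 0 ≤ δ) :
    VertexFamily (fun μ w => cΛ • hessFFAt (d := d) (toSite r) Lc μ w) Lc
      (|cΛ| * (2 * (ell (d + 1) Lc : ℝ) ^ 2 * Real.exp (4 * ((d : ℝ) + 1) * Lc * δ))) δ :=
  fun μ w => SecondOrderResponse.biLoc_smul cΛ (biLoc_hessFFAt hLc μ w hr hδ)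

/-! ## §1 The uniform W-row of the dressed family as a function of the slot rows -/

section Generic

variable {r : Fin (d + 1) → ℕ}

/-- NOT IN PRINT; OUR BOOKKEEPING — A SOCKET (generic `d`, in-block root; [folklore] assembly).  **THE W-SLOT's UNIFORM HALF `hW` FOR THE RECURSIVE FAMILY
`WrecAt (toSite r)` AS A FUNCTION OF THE DRESSED K-ROW, «S′Shape» AND «T2Shape»**: from the uniform unit decay of the dressed one-step resolvents
`unitK (sfStep Lc j) (smStep d Lc j) (coDressKBmAt (toSite r) Lc (KInvStep Lc j))` (`hG`, rate `δ > 0`), the uniform `LocStencil` row of the normalised unfolded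
first-order tables `unitS … (SpureRecAt … j)` (`hS`), the uniform `LocStencil₂` row of the normalised recursive second-order tables `unitS₂ … (T2RecAt … j)` (`hT₂`)
and the mixed binder table's own `LocStencilFM` + field–field support (`hmix`, `hfm`, `hm`):
`∃ Cw δW, 0 < δW ∧ ∀ j, VertexFamily₂ (unitW (sfStep Lc j) (smStep d Lc j) (WrecAt d Lc (toSite r) … j)) Lc Cw δW`.
Route = leaf-07's `hW_of_shapes` verbatim over the dressed slots: `unitW_WrecAt` + `unitM_M1At_eq` + `unitM₂_M2Of_eq` + an1's `vertexFamily₂_W2SymOfK` at the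
common rate `m := min (min (min δ δs) δ₂) δ₄` (constant `CW2 d C Cs CM C₂ CM₂ m`, rate `m∕16`).  The three slot rows are NOT proved here. -/
theorem hW_WrecAt_of_shapes (hLc : 1 ≤ Lc) (hr : r ∈ box (d + 1) Lc) {C δ : ℝ}
    (hG : ∀ j, Decays (unitK (sfStep Lc j) (smStep d Lc j) (coDressKBmAt (toSite r) Lc (KInvStep (d := d) Lc j))) C δ) (hδ : 0 < δ)
    (cE cVH cΛ cE₂ cB : ℝ) (T : Fin 4 → Fin 4 → Fin 4 → Fin 4 → ℝ)
    (vh₂S : Fin (d + 1) → (Fin (d + 1) → ℤ) → Fin (d + 1) → (Fin (d + 1) → ℤ) → MKer (d + 1) (Fib d))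
    {mixFF : Fin (d + 1) → (Fin (d + 1) → ℤ) → Fin (d + 1) → (Fin (d + 1) → ℤ) → MKer (d + 1) (Fib d)}
    {Cs δs : ℝ} (hS : ∀ j, LocStencil (unitS (sfStep Lc j) (smStep d Lc j) (SpureRecAt d Lc (toSite r) cE cVH cΛ j)) Cs δs) (hδs : 0 < δs)
    {C₂ δ₂ : ℝ}
    (hT₂ : ∀ j, LocStencil₂ (unitS₂ (sfStep Lc j) (smStep d Lc j) (T2RecAt d Lc (toSite r) cE cVH cΛ cE₂ cB T vh₂S mixFF j)) C₂ δ₂)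
    (hδ₂ : 0 < δ₂) {CM₂ δ₄ : ℝ} (hmix : LocStencilFM Lc mixFF CM₂ δ₄) (hδ₄ : 0 < δ₄)
    (hfm : ∀ κ u ρ w x z (α μ' : Fin (d + 1)), mixFF κ u ρ w x z (Sum.inl α) (Sum.inr μ') = 0)
    (hm : ∀ κ u ρ w x z (μ' : Fin (d + 1)) (b : Fib d), mixFF κ u ρ w x z (Sum.inr μ') b = 0) :
    ∃ Cw δW : ℝ, 0 < δW ∧
      ∀ j, VertexFamily₂ (unitW (sfStep Lc j) (smStep d Lc j) (WrecAt d Lc (toSite r) cE cVH cΛ cE₂ cB T vh₂S mixFF j)) Lc Cw δW := by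
  have hC : 0 ≤ C := (hG 0).nonneg (Sum.inl 0)
  have hCs : 0 ≤ Cs := ((hS 0) 0 0).nonneg (Sum.inl 0)
  -- the common rate
  set m : ℝ := min (min (min δ δs) δ₂) δ₄ with hm_def
  have hm0 : 0 < m := lt_min (lt_min (lt_min hδ hδs) hδ₂) hδ₄
  have hm4 : m ≤ δ₄ := min_le_right _ _
  have hm2 : m ≤ δ₂ := (min_le_left _ _).trans (min_le_right _ _)
  have hms : m ≤ δs := (min_le_left _ _).trans ((min_le_left _ _).trans (min_le_right _ _))
  have hmK : m ≤ δ := (min_le_left _ _).trans ((min_le_left _ _).trans (min_le_left _ _))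
  -- the `j`-free multiplier-table constant at the common rate
  set CM : ℝ := |cΛ| * (2 * (ell (d + 1) Lc : ℝ) ^ 2 * Real.exp (4 * ((d : ℝ) + 1) * Lc * m)) with hCM_def
  refine ⟨CW2 d C Cs CM C₂ CM₂ m, m / 16, by positivity, fun j => ?_⟩
  have hK' : Decays (unitK (sfStep Lc j) (smStep d Lc j) (coDressKBmAt (toSite r) Lc (KInvStep (d := d) Lc j))) C m :=
    decays_mono (hG j) hC le_rfl hmK
  have hS' : LocStencil (unitS (sfStep Lc j) (smStep d Lc j) (SpureRecAt d Lc (toSite r) cE cVH cΛ j)) Cs m :=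
    locStencil_mono' (hS j) le_rfl hms
  have hM' : VertexFamily (unitM (sfStep Lc j) (smStep d Lc j) (M1At d Lc (toSite r) cΛ j)) Lc CM m := by
    rw [unitM_M1At_eq]
    exact vertexFamily_smul_hessFFAt hLc hr cΛ hm0.le
  have hT' : LocStencil₂ (unitS₂ (sfStep Lc j) (smStep d Lc j) (T2RecAt d Lc (toSite r) cE cVH cΛ cE₂ cB T vh₂S mixFF j)) C₂ m :=
    (hT₂ j).mono hm2
  have hX' : LocStencilFM Lc (unitM₂ (sfStep Lc j) (smStep d Lc j) (M2Of d Lc mixFF j)) CM₂ m :=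
    (locStencilFM_unitM₂_M2Of hmix hfm hm j).mono hm4
  rw [unitW_WrecAt (sfStep_ne_zero j) (smStep_ne_zero j)]
  exact vertexFamily₂_W2SymOfK hK' hC hm0 hS' hM' hT' hX'

/-! ## §2 The Cauchy W-row of the dressed family as a function of the slot rows -/

/-- NOT IN PRINT; OUR BOOKKEEPING — A SOCKET (generic `d`, in-block root; [folklore] assembly).  **THE W-SLOT's CAUCHY HALF `hWall` FOR THE RECURSIVE FAMILY
`WrecAt (toSite r)` AS A FUNCTION OF THE DRESSED K-ROWS, «S′Shape» ∧ «S′Drift», «T2Shape» ∧ «T2Drift»**: uniform rows as in `hW_WrecAt_of_shapes` plus the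
geometric all-scales Cauchy rows of the three moving slots — `hGall` (ratio `θK`), `hSall` (ratio `θS`), `hT₂d` (ratio `θ₂`) — give
`∃ cW θW δW, 0 ≤ θW < 1 ∧ 0 < δW ∧ ∀ k j, VertexFamily₂ (unitW … (k+j) (WrecAt … (k+j)) − unitW … k (WrecAt … k)) Lc (cW·θW^k) δW`,
`θW = max θK (max θS θ₂)`.  Route = leaf-07's `WSlotCauchyOfShapes.hWall_of_shapes` verbatim over the dressed slots: the multiplier slot (`unitM_M1At_eq`) and the
mixed slot (`unitM₂_M2Of_eq`) are `j`-free (zero deviations), then `SecondOrderLipschitzW2.vertexFamily₂_W2SymOfK_sub` at the common rate.  No slot row is proved here. -/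
theorem hWall_WrecAt_of_shapes (hLc : 1 ≤ Lc) (hr : r ∈ box (d + 1) Lc) {C δ cK θK : ℝ}
    (hG : ∀ j, Decays (unitK (sfStep Lc j) (smStep d Lc j) (coDressKBmAt (toSite r) Lc (KInvStep (d := d) Lc j))) C δ)
    (hGall : ∀ k j, Decays (unitK (sfStep Lc (k + j)) (smStep d Lc (k + j)) (coDressKBmAt (toSite r) Lc (KInvStep (d := d) Lc (k + j))) -
      unitK (sfStep Lc k) (smStep d Lc k) (coDressKBmAt (toSite r) Lc (KInvStep (d := d) Lc k))) (cK * θK ^ k) δ)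
    (hδ : 0 < δ) (hθK0 : 0 ≤ θK) (hθK1 : θK < 1)
    (cE cVH cΛ cE₂ cB : ℝ) (T : Fin 4 → Fin 4 → Fin 4 → Fin 4 → ℝ)
    (vh₂S : Fin (d + 1) → (Fin (d + 1) → ℤ) → Fin (d + 1) → (Fin (d + 1) → ℤ) → MKer (d + 1) (Fib d))
    {mixFF : Fin (d + 1) → (Fin (d + 1) → ℤ) → Fin (d + 1) → (Fin (d + 1) → ℤ) → MKer (d + 1) (Fib d)}
    {Cs cS θS δs : ℝ} (hS : ∀ j, LocStencil (unitS (sfStep Lc j) (smStep d Lc j) (SpureRecAt d Lc (toSite r) cE cVH cΛ j)) Cs δs)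
    (hSall : ∀ k j, LocStencil (unitS (sfStep Lc (k + j)) (smStep d Lc (k + j)) (SpureRecAt d Lc (toSite r) cE cVH cΛ (k + j)) -
      unitS (sfStep Lc k) (smStep d Lc k) (SpureRecAt d Lc (toSite r) cE cVH cΛ k)) (cS * θS ^ k) δs)
    (hδs : 0 < δs) (hθS0 : 0 ≤ θS) (hθS1 : θS < 1)
    {C₂ c₂ θ₂ δ₂ : ℝ}
    (hT₂ : ∀ j, LocStencil₂ (unitS₂ (sfStep Lc j) (smStep d Lc j) (T2RecAt d Lc (toSite r) cE cVH cΛ cE₂ cB T vh₂S mixFF j)) C₂ δ₂)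
    (hT₂d : ∀ k j, LocStencil₂ (unitS₂ (sfStep Lc (k + j)) (smStep d Lc (k + j)) (T2RecAt d Lc (toSite r) cE cVH cΛ cE₂ cB T vh₂S mixFF (k + j)) -
      unitS₂ (sfStep Lc k) (smStep d Lc k) (T2RecAt d Lc (toSite r) cE cVH cΛ cE₂ cB T vh₂S mixFF k)) (c₂ * θ₂ ^ k) δ₂)
    (hδ₂ : 0 < δ₂) (hθ₂0 : 0 ≤ θ₂) (hθ₂1 : θ₂ < 1)
    {CM₂ δ₄ : ℝ} (hmix : LocStencilFM Lc mixFF CM₂ δ₄) (hδ₄ : 0 < δ₄)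
    (hfm : ∀ κ u ρ w x z (α μ' : Fin (d + 1)), mixFF κ u ρ w x z (Sum.inl α) (Sum.inr μ') = 0)
    (hm : ∀ κ u ρ w x z (μ' : Fin (d + 1)) (b : Fib d), mixFF κ u ρ w x z (Sum.inr μ') b = 0) :
    ∃ cW θW δW : ℝ, 0 ≤ θW ∧ θW < 1 ∧ 0 < δW ∧
      ∀ k j, VertexFamily₂ (unitW (sfStep Lc (k + j)) (smStep d Lc (k + j)) (WrecAt d Lc (toSite r) cE cVH cΛ cE₂ cB T vh₂S mixFF (k + j)) -
        unitW (sfStep Lc k) (smStep d Lc k) (WrecAt d Lc (toSite r) cE cVH cΛ cE₂ cB T vh₂S mixFF k)) Lc (cW * θW ^ k) δW := by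
  -- nonnegativity of the data constants
  have hC : 0 ≤ C := (hG 0).nonneg (Sum.inl 0)
  have hcK : 0 ≤ cK := by have h := (hGall 0 0).nonneg (Sum.inl 0); simpa using h
  have hCs : 0 ≤ Cs := ((hS 0) 0 0).nonneg (Sum.inl 0)
  have hcS : 0 ≤ cS := by have h := ((hSall 0 0) 0 0).nonneg (Sum.inl 0); simpa using h
  have hC₂ : 0 ≤ C₂ := (hT₂ 0).nonneg
  have hc₂ : 0 ≤ c₂ := by have h := (hT₂d 0 0).nonneg; simpa using h
  have hCM₂ : 0 ≤ CM₂ := hmix.nonneg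
  -- the common ratio and the common rate
  set θW : ℝ := max θK (max θS θ₂) with hθW_def
  have hθW0 : 0 ≤ θW := hθK0.trans (le_max_left _ _)
  have hθW1 : θW < 1 := max_lt hθK1 (max_lt hθS1 hθ₂1)
  have hKW : θK ≤ θW := le_max_left _ _
  have hSW : θS ≤ θW := (le_max_left _ _).trans (le_max_right _ _)
  have h2W : θ₂ ≤ θW := (le_max_right _ _).trans (le_max_right _ _)
  set m : ℝ := min δ (min δs (min δ₂ δ₄)) with hm_def
  have hm0 : 0 < m := lt_min hδ (lt_min hδs (lt_min hδ₂ hδ₄))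
  have hmδ : m ≤ δ := min_le_left _ _
  have hms : m ≤ δs := (min_le_right _ _).trans (min_le_left _ _)
  have hm2 : m ≤ δ₂ := (min_le_right _ _).trans ((min_le_right _ _).trans (min_le_left _ _))
  have hm4 : m ≤ δ₄ := (min_le_right _ _).trans ((min_le_right _ _).trans (min_le_right _ _))
  -- the `j`-free multiplier table at the common rate
  set CM : ℝ := |cΛ| * (2 * (ell (d + 1) Lc : ℝ) ^ 2 * Real.exp (4 * ((d : ℝ) + 1) * Lc * m)) with hCM_def
  have hM : VertexFamily (fun μ w => cΛ • hessFFAt (d := d) (toSite r) Lc μ w) Lc CM m := vertexFamily_smul_hessFFAt hLc hr cΛ hm0.le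
  have hmixm : LocStencilFM Lc mixFF CM₂ m := hmix.mono hm4
  refine ⟨LW2 d C Cs CM C₂ CM₂ cK cS 0 c₂ 0 m, θW, m / 16, hθW0, hθW1, by positivity, fun k j => ?_⟩
  -- the data of the pair `(k+j, k)` at the common rate and the common ratio
  have hK1 : Decays (unitK (sfStep Lc (k + j)) (smStep d Lc (k + j)) (coDressKBmAt (toSite r) Lc (KInvStep (d := d) Lc (k + j)))) C m :=
    decays_mono (hG (k + j)) hC le_rfl hmδ
  have hK0 : Decays (unitK (sfStep Lc k) (smStep d Lc k) (coDressKBmAt (toSite r) Lc (KInvStep (d := d) Lc k))) C m :=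
    decays_mono (hG k) hC le_rfl hmδ
  have hKK : Decays (unitK (sfStep Lc (k + j)) (smStep d Lc (k + j)) (coDressKBmAt (toSite r) Lc (KInvStep (d := d) Lc (k + j))) -
      unitK (sfStep Lc k) (smStep d Lc k) (coDressKBmAt (toSite r) Lc (KInvStep (d := d) Lc k))) (cK * θW ^ k) m :=
    decays_mono (hGall k j) (by positivity) (mul_pow_le_mul_pow hcK hθK0 hKW k) hmδ
  have hS1 : LocStencil (unitS (sfStep Lc (k + j)) (smStep d Lc (k + j)) (SpureRecAt d Lc (toSite r) cE cVH cΛ (k + j))) Cs m :=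
    locStencil_mono' (hS (k + j)) le_rfl hms
  have hS0 : LocStencil (unitS (sfStep Lc k) (smStep d Lc k) (SpureRecAt d Lc (toSite r) cE cVH cΛ k)) Cs m :=
    locStencil_mono' (hS k) le_rfl hms
  have hSS : LocStencil (unitS (sfStep Lc (k + j)) (smStep d Lc (k + j)) (SpureRecAt d Lc (toSite r) cE cVH cΛ (k + j)) -
      unitS (sfStep Lc k) (smStep d Lc k) (SpureRecAt d Lc (toSite r) cE cVH cΛ k)) (cS * θW ^ k) m :=
    locStencil_mono' (hSall k j) (mul_pow_le_mul_pow hcS hθS0 hSW k) hms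
  have hT1 : LocStencil₂ (unitS₂ (sfStep Lc (k + j)) (smStep d Lc (k + j)) (T2RecAt d Lc (toSite r) cE cVH cΛ cE₂ cB T vh₂S mixFF (k + j))) C₂ m :=
    locStencil₂_le_mono (hT₂ (k + j)) le_rfl hm2
  have hT0 : LocStencil₂ (unitS₂ (sfStep Lc k) (smStep d Lc k) (T2RecAt d Lc (toSite r) cE cVH cΛ cE₂ cB T vh₂S mixFF k)) C₂ m :=
    locStencil₂_le_mono (hT₂ k) le_rfl hm2
  have hTT : LocStencil₂ (unitS₂ (sfStep Lc (k + j)) (smStep d Lc (k + j)) (T2RecAt d Lc (toSite r) cE cVH cΛ cE₂ cB T vh₂S mixFF (k + j)) -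
      unitS₂ (sfStep Lc k) (smStep d Lc k) (T2RecAt d Lc (toSite r) cE cVH cΛ cE₂ cB T vh₂S mixFF k)) (c₂ * θW ^ k) m :=
    locStencil₂_le_mono (hT₂d k j) (mul_pow_le_mul_pow hc₂ hθ₂0 h2W k) hm2
  -- the multiplier and mixed slots do not move: zero deviations
  have hθk : (0 : ℝ) ≤ 0 * θW ^ k := by positivity
  have hMM : VertexFamily ((fun μ w => cΛ • hessFFAt (d := d) (toSite r) Lc μ w) - fun μ w => cΛ • hessFFAt (d := d) (toSite r) Lc μ w) Lc
      (0 * θW ^ k) m := by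
    rw [sub_self]; exact vertexFamily_zero hθk
  have hMM₂ : LocStencilFM Lc (mixFF - mixFF) (0 * θW ^ k) m := by
    rw [sub_self]; exact locStencilFM_zero hθk
  -- rewrite both members as the carrier over the normalised data; the multiplier and mixed slots are `j`-free
  rw [unitW_WrecAt (sfStep_ne_zero (k + j)) (smStep_ne_zero (k + j)), unitW_WrecAt (sfStep_ne_zero k) (smStep_ne_zero k),
    unitM_M1At_eq, unitM_M1At_eq, unitM₂_M2Of_eq hfm hm, unitM₂_M2Of_eq hfm hm]
  have h := vertexFamily₂_W2SymOfK_sub (N := Lc) hK1 hK0 hKK hm0 hS1 hS0 hSS hM hM hMM hT1 hT0 hTT hmixm hmixm hMM₂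
  rw [LW2_mul] at h
  exact h

/-! ## §3 Both W-rows at one common rate -/

/-- NOT IN PRINT; OUR BOOKKEEPING — A SOCKET (generic `d`, in-block root).  **BOTH W-ROWS OF THE WALL FOR THE RECURSIVE FAMILY `WrecAt (toSite r)`, AT ONE
COMMON DECAY RATE** (the consumer's shape: `hW` and `hWall` share `δW`): §1 and §2, rates merged by monotonicity.  No slot row is proved here. -/
theorem hW_hWall_WrecAt_of_shapes (hLc : 1 ≤ Lc) (hr : r ∈ box (d + 1) Lc) {C δ cK θK : ℝ}
    (hG : ∀ j, Decays (unitK (sfStep Lc j) (smStep d Lc j) (coDressKBmAt (toSite r) Lc (KInvStep (d := d) Lc j))) C δ)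
    (hGall : ∀ k j, Decays (unitK (sfStep Lc (k + j)) (smStep d Lc (k + j)) (coDressKBmAt (toSite r) Lc (KInvStep (d := d) Lc (k + j))) -
      unitK (sfStep Lc k) (smStep d Lc k) (coDressKBmAt (toSite r) Lc (KInvStep (d := d) Lc k))) (cK * θK ^ k) δ)
    (hδ : 0 < δ) (hθK0 : 0 ≤ θK) (hθK1 : θK < 1)
    (cE cVH cΛ cE₂ cB : ℝ) (T : Fin 4 → Fin 4 → Fin 4 → Fin 4 → ℝ)
    (vh₂S : Fin (d + 1) → (Fin (d + 1) → ℤ) → Fin (d + 1) → (Fin (d + 1) → ℤ) → MKer (d + 1) (Fib d))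
    {mixFF : Fin (d + 1) → (Fin (d + 1) → ℤ) → Fin (d + 1) → (Fin (d + 1) → ℤ) → MKer (d + 1) (Fib d)}
    {Cs cS θS δs : ℝ} (hS : ∀ j, LocStencil (unitS (sfStep Lc j) (smStep d Lc j) (SpureRecAt d Lc (toSite r) cE cVH cΛ j)) Cs δs)
    (hSall : ∀ k j, LocStencil (unitS (sfStep Lc (k + j)) (smStep d Lc (k + j)) (SpureRecAt d Lc (toSite r) cE cVH cΛ (k + j)) -
      unitS (sfStep Lc k) (smStep d Lc k) (SpureRecAt d Lc (toSite r) cE cVH cΛ k)) (cS * θS ^ k) δs)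
    (hδs : 0 < δs) (hθS0 : 0 ≤ θS) (hθS1 : θS < 1)
    {C₂ c₂ θ₂ δ₂ : ℝ}
    (hT₂ : ∀ j, LocStencil₂ (unitS₂ (sfStep Lc j) (smStep d Lc j) (T2RecAt d Lc (toSite r) cE cVH cΛ cE₂ cB T vh₂S mixFF j)) C₂ δ₂)
    (hT₂d : ∀ k j, LocStencil₂ (unitS₂ (sfStep Lc (k + j)) (smStep d Lc (k + j)) (T2RecAt d Lc (toSite r) cE cVH cΛ cE₂ cB T vh₂S mixFF (k + j)) -
      unitS₂ (sfStep Lc k) (smStep d Lc k) (T2RecAt d Lc (toSite r) cE cVH cΛ cE₂ cB T vh₂S mixFF k)) (c₂ * θ₂ ^ k) δ₂)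
    (hδ₂ : 0 < δ₂) (hθ₂0 : 0 ≤ θ₂) (hθ₂1 : θ₂ < 1)
    {CM₂ δ₄ : ℝ} (hmix : LocStencilFM Lc mixFF CM₂ δ₄) (hδ₄ : 0 < δ₄)
    (hfm : ∀ κ u ρ w x z (α μ' : Fin (d + 1)), mixFF κ u ρ w x z (Sum.inl α) (Sum.inr μ') = 0)
    (hm : ∀ κ u ρ w x z (μ' : Fin (d + 1)) (b : Fib d), mixFF κ u ρ w x z (Sum.inr μ') b = 0) :
    ∃ Cw cW θW δW : ℝ, 0 ≤ θW ∧ θW < 1 ∧ 0 < δW ∧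
      (∀ j, VertexFamily₂ (unitW (sfStep Lc j) (smStep d Lc j) (WrecAt d Lc (toSite r) cE cVH cΛ cE₂ cB T vh₂S mixFF j)) Lc Cw δW) ∧
      (∀ k j, VertexFamily₂ (unitW (sfStep Lc (k + j)) (smStep d Lc (k + j)) (WrecAt d Lc (toSite r) cE cVH cΛ cE₂ cB T vh₂S mixFF (k + j)) -
        unitW (sfStep Lc k) (smStep d Lc k) (WrecAt d Lc (toSite r) cE cVH cΛ cE₂ cB T vh₂S mixFF k)) Lc (cW * θW ^ k) δW) := by
  obtain ⟨Cw, δ₁, hδ₁, hW⟩ := hW_WrecAt_of_shapes hLc hr hG hδ cE cVH cΛ cE₂ cB T vh₂S hS hδs hT₂ hδ₂ hmix hδ₄ hfm hm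
  obtain ⟨cW, θW, δ₅, hθW0, hθW1, hδ₅, hWall⟩ := hWall_WrecAt_of_shapes hLc hr hG hGall hδ hθK0 hθK1 cE cVH cΛ cE₂ cB T vh₂S hS hSall hδs hθS0
    hθS1 hT₂ hT₂d hδ₂ hθ₂0 hθ₂1 hmix hδ₄ hfm hm
  have hCw : 0 ≤ Cw := ((hW 0) 0 0 0 0).nonneg (Sum.inl 0)
  have hcW : 0 ≤ cW := by have h := ((hWall 0 0) 0 0 0 0).nonneg (Sum.inl 0); simpa using h
  exact ⟨Cw, cW, θW, min δ₁ δ₅, hθW0, hθW1, lt_min hδ₁ hδ₅, fun j => vertexFamily₂_mono (hW j) hCw (min_le_left _ _), fun k j =>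
    vertexFamily₂_mono (hWall k j) (by positivity) (min_le_right _ _)⟩

end Generic

/-! ## §4 `d = 3`, `Lc ≥ 2`, an1's rooted mixed table: the W-rows of the comb family wait on the two recursive slots only -/

section Three

variable {Lc : ℕ} [NeZero Lc] {r : Fin (3 + 1) → ℕ}

/-- NOT IN PRINT; OUR PROOF ATTEMPT — A SOCKET (`d = 3`, `2 ≤ Lc`, in-block root `r`, an1's rooted mixed table `mixFFAt (toSite r) Lc`; every colour
constant, every Wilson position table `T`, every second-order border `vh₂S`).  **THE W-SLOT ROWS (hW, hWall) OF an2's RECURSIVE WALL FAMILY `WrecAt` FROM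
«S′Shape» ∧ «S′Drift» AND «T2Shape» ∧ «T2Drift» ALONE**: the dressed K-rows are asym1's `HessKerCoDressedBmWall.exists_coDressedBm_unit_rows` over road P1's
`KSlotAssembly.convCKWall_holds` (TREE, hypothesis-free), the mixed-table letters an1's `MixedJetTablesPlug.hmix_an1` ∕ `AveragingMixedJetTables.mixFFAt_inl_inr` ∕ `mixFFAt_inr`.  The
conclusion is LITERALLY the pair of binders `hW` ∕ `hWall` (with `0 < δW`, `0 ≤ θW < 1`) of the D1 literal of record's
`D1BFx.RoadEndRowPinned.exists_allScalesSeq_JsRowD1Pin_of_slots` at `r := ctrOff (3+1) Lc`, `(cE, cVH, cΛ, cE₂, cB) := (Lc^4, −Lc^8∕2, 2∕Lc^4, Lc^8, −Lc^12∕4)`,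
`T := (8N²)⁻¹ • wsym22 N`, `vh₂S := vh₂SAn1 Lc`.  Discharges NOTHING of (hW, hWall): the four slot rows are OPEN (CT-W); NEVER «G-an2-4 closed» as (CONV-C). -/
theorem hW_hWall_WrecAt_three_of_rows (hLc : 2 ≤ Lc) (hr : r ∈ box (3 + 1) Lc) (cE cVH cΛ cE₂ cB : ℝ) (T : Fin 4 → Fin 4 → Fin 4 → Fin 4 → ℝ)
    (vh₂S : Fin (3 + 1) → (Fin (3 + 1) → ℤ) → Fin (3 + 1) → (Fin (3 + 1) → ℤ) → MKer (3 + 1) (Fib 3))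
    {Cs cS θS δs : ℝ} (hS : ∀ j, LocStencil (unitS (sfStep Lc j) (smStep 3 Lc j) (SpureRecAt 3 Lc (toSite r) cE cVH cΛ j)) Cs δs)
    (hSall : ∀ k j, LocStencil (unitS (sfStep Lc (k + j)) (smStep 3 Lc (k + j)) (SpureRecAt 3 Lc (toSite r) cE cVH cΛ (k + j)) -
      unitS (sfStep Lc k) (smStep 3 Lc k) (SpureRecAt 3 Lc (toSite r) cE cVH cΛ k)) (cS * θS ^ k) δs)
    (hδs : 0 < δs) (hθS0 : 0 ≤ θS) (hθS1 : θS < 1)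
    {C₂ c₂ θ₂ δ₂ : ℝ}
    (hT₂ : ∀ j, LocStencil₂ (unitS₂ (sfStep Lc j) (smStep 3 Lc j)
      (T2RecAt 3 Lc (toSite r) cE cVH cΛ cE₂ cB T vh₂S (mixFFAt (toSite r) Lc) j)) C₂ δ₂)
    (hT₂d : ∀ k j, LocStencil₂ (unitS₂ (sfStep Lc (k + j)) (smStep 3 Lc (k + j))
        (T2RecAt 3 Lc (toSite r) cE cVH cΛ cE₂ cB T vh₂S (mixFFAt (toSite r) Lc) (k + j)) -
      unitS₂ (sfStep Lc k) (smStep 3 Lc k) (T2RecAt 3 Lc (toSite r) cE cVH cΛ cE₂ cB T vh₂S (mixFFAt (toSite r) Lc) k)) (c₂ * θ₂ ^ k) δ₂)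
    (hδ₂ : 0 < δ₂) (hθ₂0 : 0 ≤ θ₂) (hθ₂1 : θ₂ < 1) :
    ∃ Cw cW θW δW : ℝ, 0 ≤ θW ∧ θW < 1 ∧ 0 < δW ∧
      (∀ j, VertexFamily₂ (unitW (sfStep Lc j) (smStep 3 Lc j)
        (WrecAt 3 Lc (toSite r) cE cVH cΛ cE₂ cB T vh₂S (mixFFAt (toSite r) Lc) j)) Lc Cw δW) ∧
      (∀ k j, VertexFamily₂ (unitW (sfStep Lc (k + j)) (smStep 3 Lc (k + j))
          (WrecAt 3 Lc (toSite r) cE cVH cΛ cE₂ cB T vh₂S (mixFFAt (toSite r) Lc) (k + j)) -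
        unitW (sfStep Lc k) (smStep 3 Lc k) (WrecAt 3 Lc (toSite r) cE cVH cΛ cE₂ cB T vh₂S (mixFFAt (toSite r) Lc) k)) Lc (cW * θW ^ k) δW) := by
  have hLc1 : 1 ≤ Lc := by omega
  -- road P1's K-pair, transported through asym1's block-mean co-dressing socket (rate `δK/4`)
  obtain ⟨C, δK, cK, θK, hδK, hθK0, hθK1, hK, hKall⟩ := convCKWall_holds (Lc := Lc) hLc
  obtain ⟨c, -, hG, hGall⟩ := exists_coDressedBm_unit_rows hLc1 hr (sfStep Lc) (smStep 3 Lc) sfStep_ne_zero smStep_ne_zero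
    (K := fun j => KInvStep (d := 3) Lc j) hδK hK hKall
  -- an1's rooted mixed table
  obtain ⟨CM₂, δ₄, hδ₄, hmix⟩ := hmix_an1 (d := 3) (Lc := Lc) hLc1 hr
  exact hW_hWall_WrecAt_of_shapes hLc1 hr hG hGall (by positivity) hθK0 hθK1 cE cVH cΛ cE₂ cB T vh₂S hS hSall hδs hθS0 hθS1 hT₂ hT₂d hδ₂
    hθ₂0 hθ₂1 hmix hδ₄
    (fun κ u ρ' w x z α μ' => mixFFAt_inl_inr (toSite r) Lc κ u ρ' w x z α μ') (fun κ u ρ' w x z μ' b => mixFFAt_inr (toSite r) Lc κ u ρ' w x z μ' b)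

end Three

end Summit.QuantumFields.BalabanUV.Beta.GAN24.WrecAtSlotOfShapes

end
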